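import Summits.ResolutionOfSingularities.ResolutionOfSingularities.Theorems.EquisingularLiftEquisingularLiftNatPrefixSupplierDefs
import Summits.ResolutionOfSingularities.ResolutionOfSingularities.Theorems.EquisingularLiftEquisingularLiftNatNodalHostedRoundOfCurveLift
import HarnessLib

/-!
# [OURS · L1 W4.5(b) · EL♮(3) · WIDTH TABLE W₂ «Σ-SECTION ROUND», slot HROUND-SEC, part (C)] THE SECTION ROUND FROM A Σ-LICENCE:
# `TCPlus.hround_sec_of_secCurveLift : «Σ-licence» → HRoundSecSupplier k 3`

res-L1-w45b-stub-2 g20 (parallelisation of desk R73d's part (C); owner of the W₂ composition `TCPlus.hround_sec` is res-L1-w45b-nose-w1 g6,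
whose part (B) `…NatSecCurveLift` DISCHARGES the licence slot below; this file is the slot-parametric port so that (C) lands before (B)).
OURS = this programme's bookkeeping; NOT a statement of any manuscript ([Hironaka2017] is a candidate under adjudication, nothing of it is
asserted); AI-written, weaker than expert review.  No `sorry`; standard axioms; DEF-FREE; ONE explicit hypothesis `hSL` (the «Σ-licence», a
∀-statement, NOT a named fact).  `--supports stmt-ResolutionOfSingularities-20148 --as helper`, counted 0.

WHAT.
* The «Σ-LICENCE» (binder `hSL`) = ✓ `NodalCurveLiftAt`'s text (…NatNodalCurveLiftDefs :55–:88) closed over `∀ (O θ P X σ q 𝓔)`, with the two NODAL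
  binders (N2) «`Ẽ` regular along `Z̃`» and (N4) «a normal section that is a unit at the non-regular points» REPLACED by the W₂ letter (L2) «at every
  closed `z ∈ Z`: `𝓘⟨Z⟩_z = 𝓘⟨E⟩_z + (f)` with `f ∉ 𝓘⟨E⟩_z + 𝔪_z²`» in `G`-stalk currency (the bytes of `HRoundSecSupplier`'s letter), the 2-frame
  clause of the output DROPPED (output = `∃ C, 𝓔 ≤ C ∧ V(C) regular ∧ O-flat ∧ C·𝒪_G = 𝓘⟨Z⟩`), and four SPARE antecedents the call site owns for free
  (`𝓔` has principal stalks, `𝓔 ≠ ⊥`, `σ ≫ q` proper, `[IsAlgClosed (ResidueField O)]`) so that any discharge variant plugs in by a λ.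
* ★ `TCPlus.hround_sec_of_secCurveLift (k) (hSL) : HRoundSecSupplier k 3` — ✓ `nodalHostedRoundFact_of_nodalCurveLiftFact` (…NatNodalHostedRoundOfCurveLift
  :133–:227, res-L1-w45b-stub-4 g14) ported VERBATIM with its ONE licence call re-pointed to `hSL` (fed (N1) = `hZfin`, (D1) = `hZdim`, (D2) = ✓
  `ringKrullDim_redSub_stalk_eq_two_of_letter` at the host letter, (L2) = the slot's letter, `DirStepUnobs`): E1-legality ✓
  `image_support_subset_not_isGenericPoint_of_chain`, the `Ch`-stage of the blow-up ✓ `modelStep_chain`, the 2-frames ✓ `hFrame_of_ringKrullDim_redSub`,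
  the host letter's strict transform ✓ `TCPlus.letterDatum_transport_hostedRound'`, the other listed letters ✓ `TCPlus.crossedLetter_clausesN` (no
  regularity of `Z̃` used), the exceptional letter's birth ✓ `TCPlus.excLetter_birth₀`.
The intended instance (not here): `TCPlus.hround_sec k := TCPlus.hround_sec_of_secCurveLift k (secCurveLift …)` once nose-w1's (B) lands
(✓ `embeddedLiftFact_holds` p704265 + ✓ `SecCurve.exists_affineOpens_isWeaklyRegular_ker` p708682 + ✓ `SectionLift.isRegular_subscheme_of_paramLift` p707813).
[folklore; pure composition] [cite: Matsumura1987, Thm. 15.1 — via the imported (D2) read-off only]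
-/

set_option linter.dupNamespace false -- mandated namespace `Summit.<Summit>.<Problem>` of this single-conjunct summit
set_option linter.overlappingInstances false -- signatures carry `[IsDomain O] [IsDiscreteValuationRing O]`

noncomputable section

open CategoryTheory CategoryTheory.Limits AlgebraicGeometry TopologicalSpace Topology IsLocalRing
open Literature.AlgebraicGeometry.Resolution
open AlgebraicGeometry.Scheme.IdealSheafData
open Summit.ResolutionOfSingularities.ResolutionOfSingularities.Theses.EquisingularLift.Split
open Summit.ResolutionOfSingularities.ResolutionOfSingularities.Cruxes.EquisingularLift.StrataSplit

namespace Summit.ResolutionOfSingularities.ResolutionOfSingularities.Cruxes.EquisingularLiftNat.Sections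

/-- ★ **THE W₂ SECTION ROUND FROM A Σ-LICENCE (slot-parametric part (C) of `TCPlus.hround_sec`).**  Given the «Σ-licence» `hSL` — for every adically
complete DVR `O ↠ k` with algebraically closed residue field, every regular integral locally Noetherian `X ⟶ P ⟶ Spec O` with `σ ≫ q` proper, every
LETTER MODEL `𝓔` (principal stalks, `≠ ⊥`, `V(𝓔)` regular, `O`-flat, proper) with reduced trace `E` on the special fibre `G`, and every closed
`Z ⊆ E` with (N1) finitely many non-regular points, (D1) `dim 𝒪_{Z̃,z} = 1`, (D2) `dim 𝒪_{Ẽ,i z} = 2`, the letter (L2) and `DirStepUnobs G E Z`: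
a centre `C ⊇ 𝓔` with `V(C)` regular, `O`-flat and `C·𝒪_G = 𝓘⟨Z⟩` — the stage-level supplier `HRoundSecSupplier k 3` holds: blow the centre up, read
the new `Ch`-stage and model square off ✓ `modelStep_chain`, transport every listed letter (host by HT2′, the others by (CL)-N) and give birth to the
exceptional letter.  Port of ✓ `nodalHostedRoundFact_of_nodalCurveLiftFact` with the licence call re-pointed. [folklore; pure composition]
[OURS · L1 W4.5b · WIDTH TABLE W₂, slot HROUND-SEC part (C); NOT a statement of the manuscript; EL♮(3) NOT proved] -/
theorem TCPlus.hround_sec_of_secCurveLift (k : Type) [Field k]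
    (hSL : ∀ (O : Type) [CommRing O] [IsDomain O] [IsDiscreteValuationRing O] [IsAdicComplete (maximalIdeal O) O]
        [IsAlgClosed (ResidueField O)] (θ : O →+* k), Function.Surjective θ →
      ∀ {P : Scheme.{0}} (X : Scheme.{0}) (σ : X ⟶ P) (q : P ⟶ Spec (.of O)) (𝓔 : X.IdealSheafData),
        IsIntegral X → IsLocallyNoetherian X → Scheme.IsRegular X → IsProper (σ ≫ q) →
        (∀ x : X, (stalkIdeal 𝓔 x).IsPrincipal) → 𝓔 ≠ ⊥ →
        Scheme.IsRegular 𝓔.subscheme → Flat (𝓔.subschemeι ≫ σ ≫ q) → IsProper (𝓔.subschemeι ≫ σ ≫ q) →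
        ∀ (G : Scheme.{0}) (j : G ⟶ X) (t : G ⟶ Spec (.of k)),
          IsPullback j t (σ ≫ q) (Spec.map (CommRingCat.ofHom θ)) →
          ∀ (E : Set G) (hE : IsClosed E), 𝓔.comap j = vanishingIdeal (⟨E, hE⟩ : Closeds G) →
          ∀ (Z : Set G) (hZ : IsClosed Z), Z ⊆ E →
            Set.Finite {x : ↥(redSub G Z hZ) | ¬ IsRegularLocalRing ((redSub G Z hZ).presheaf.stalk x)} →
            (∀ z : ↥(redSub G Z hZ), IsClosed ({z} : Set ↥(redSub G Z hZ)) →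
              ringKrullDim ((redSub G Z hZ).presheaf.stalk z) = ((1 : ℕ) : WithBot ℕ∞)) →
            (∀ (i : redSub G Z hZ ⟶ redSub G E hE), i ≫ redSubι G E hE = redSubι G Z hZ →
              ∀ z : ↥(redSub G Z hZ), IsClosed ({z} : Set ↥(redSub G Z hZ)) →
                ringKrullDim ((redSub G E hE).presheaf.stalk (i z)) = ((2 : ℕ) : WithBot ℕ∞)) →
            (∀ z ∈ Z, IsClosed ({z} : Set G) → ∃ f : G.presheaf.stalk z,
              stalkIdeal (vanishingIdeal (⟨Z, hZ⟩ : Closeds G)) z =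
                  stalkIdeal (vanishingIdeal (⟨E, hE⟩ : Closeds G)) z ⊔ Ideal.span {f} ∧
                f ∉ stalkIdeal (vanishingIdeal (⟨E, hE⟩ : Closeds G)) z ⊔ (maximalIdeal (G.presheaf.stalk z)) ^ 2) →
            DirStepUnobs G E hE Z hZ →
            ∃ C : X.IdealSheafData, 𝓔 ≤ C ∧ Scheme.IsRegular C.subscheme ∧ Flat (C.subschemeι ≫ σ ≫ q) ∧
              C.comap j = vanishingIdeal (⟨Z, hZ⟩ : Closeds G)) :
    HRoundSecSupplier k 3 := by
  -- port of ✓ `nodalHostedRoundFact_of_nodalCurveLiftFact` (res-L1-w45b-stub-4 g14), licence call re-pointed to `hSL`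
  intro O _ _ _ _ _ θ hθ P q Y Ch hChStep hChSplit hYsp hYirr hYcl hPint hPnoeth hPreg hqprop hqsm X' σ' S' hCh' hX'int hX'noeth hX'reg hX'dom
    F₁ hF₁ j t hsq T₁ hT₁cl hT₁irr hjT₁ Ls hLs E₁ Z hZ F₃ υ' hE₁ hZE hZT hTZ hZfin hL2 hunobs hZdim hOthers hυ'
  classical
  haveI := hPint; haveI := hPnoeth; haveI := hX'int; haveI := hX'noeth; haveI := hF₁; haveI := hqprop; haveI := hqsm
  obtain ⟨𝓔, hEtr, hEpr, hEreg', hEoff, hEfl⟩ := hLs E₁ hE₁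
  -- properness of the stage over `O`
  have hch : Chain P Y X' σ' S' := hChSplit _ _ _ hCh'
  obtain ⟨-, -, hσ'prop⟩ := chain_isRegular P Y X' σ' S' hch hPnoeth hPreg
  haveI := hσ'prop
  have hσqprop : IsProper (σ' ≫ q) := inferInstance
  have hEprop : IsProper (𝓔.subschemeι ≫ σ' ≫ q) := inferInstance
  -- the host's model is not `⊥`: (l-iv) and the fibre of the chain over the generic point of `Y`
  obtain ⟨ξ, hξ⟩ : ∃ ξ : P, IsGenericPoint ξ Y := QuasiSober.sober hYirr hYcl
  have h𝓔0 : 𝓔 ≠ ⊥ := by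
    obtain ⟨ξ', hfib', -⟩ := Chain.fibre hch hξ
    intro h0
    have hmem : ξ' ∈ (𝓔.support : Set X') := by rw [h0, Scheme.IdealSheafData.support_bot]; trivial
    have hgen : σ' ξ' = ξ := by
      have : ξ' ∈ σ' ⁻¹' {ξ} := by rw [hfib']; exact Set.mem_singleton ξ'
      exact this
    exact hEoff ⟨ξ', hmem, rfl⟩ (hgen ▸ hξ)
  -- (D2) for the host `Ẽ₁ = redSub F₁ (closure E₁)`, at the images of the closed points of `Z̃`
  haveI : IsClosedImmersion (Spec.map (CommRingCat.ofHom θ)) := IsClosedImmersion.spec_of_surjective _ hθ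
  haveI hjci : IsClosedImmersion j := MorphismProperty.IsStableUnderBaseChange.of_isPullback hsq.flip inferInstance
  haveI : IsLocallyNoetherian F₁ := LocallyOfFiniteType.isLocallyNoetherian j
  haveI : Flat (𝓔.subschemeι ≫ σ' ≫ q) := hEfl
  have hEdim : ∀ (i : redSub F₁ Z hZ ⟶ redSub F₁ (closure E₁) isClosed_closure),
      i ≫ redSubι F₁ (closure E₁) isClosed_closure = redSubι F₁ Z hZ →
      ∀ z : ↥(redSub F₁ Z hZ), IsClosed ({z} : Set ↥(redSub F₁ Z hZ)) →
        ringKrullDim ((redSub F₁ (closure E₁) isClosed_closure).presheaf.stalk (i z)) = ((2 : ℕ) : WithBot ℕ∞) := by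
    intro i hi z hz
    refine ringKrullDim_redSub_stalk_eq_two_of_letter O k θ hθ q hξ hch j t hsq 𝓔 hEpr h𝓔0 isClosed_closure hEtr (i z) ?_
    -- `{i z}` is closed in `Ẽ₁`: its image `ι_Z z` is closed in `F₁`
    have hzF : IsClosed ({(redSubι F₁ Z hZ) z} : Set F₁) := by
      have h1 := ((redSubι F₁ Z hZ).isClosedEmbedding.isClosedMap) _ hz
      rwa [Set.image_singleton] at h1
    have h1 : ({i z} : Set ↥(redSub F₁ (closure E₁) isClosed_closure)) =
        (redSubι F₁ (closure E₁) isClosed_closure) ⁻¹' {(redSubι F₁ Z hZ) z} := by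
      ext s'
      simp only [Set.mem_singleton_iff, Set.mem_preimage]
      constructor
      · intro h; rw [h, ← Scheme.Hom.comp_apply, hi]
      · intro h
        apply (redSubι F₁ (closure E₁) isClosed_closure).isClosedEmbedding.injective
        rw [h, ← Scheme.Hom.comp_apply, hi]
    rw [h1]; exact hzF.preimage (redSubι F₁ (closure E₁) isClosed_closure).continuous
  -- THE Σ-LICENCE AT THE HOST'S MODEL: the centre `C ⊇ 𝓔` — fed (N1), (D1), (D2), (L2), `DirStepUnobs`
  obtain ⟨C, hEC, hCreg, hCfl, hCj⟩ := hSL O θ hθ X' σ' q 𝓔 hX'int hX'noeth hX'reg hσqprop hEpr h𝓔0 hEreg' hEfl hEprop F₁ j t hsq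
    (closure E₁) isClosed_closure hEtr Z hZ hZE hZfin hZdim hEdim hL2 hunobs
  have hC0 : C ≠ ⊥ := fun h => h𝓔0 (le_bot_iff.mp (h ▸ hEC))
  -- E1-legality of `C` upstairs: off the generic point of `Y`
  have hoff : σ' '' (C.support : Set X') ⊆ {y : P | ¬ IsGenericPoint y Y} :=
    image_support_subset_not_isGenericPoint_of_chain θ hθ q Y hYsp σ' S' hch j t hsq T₁ hjT₁ C Z hZ hCj hTZ
  -- the blow-up of `C`, its `Ch`-stage and the model square for `υ'`
  have hDT : (((vanishingIdeal (⟨Z, hZ⟩ : Closeds F₁)) : F₁.IdealSheafData).support : Set F₁) ⊆ T₁ := by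
    rw [Scheme.IdealSheafData.coe_support_vanishingIdeal]; exact hZT
  have hTD : ¬ T₁ ⊆ (((vanishingIdeal (⟨Z, hZ⟩ : Closeds F₁)) : F₁.IdealSheafData).support : Set F₁) := by
    rw [Scheme.IdealSheafData.coe_support_vanishingIdeal]; exact hTZ
  obtain ⟨X₃, τ₃, hτ₃⟩ := exists_isBlowup X' C
  obtain ⟨hX₃i, hX₃n, hX₃r, hX₃dom, hF₃i, hirr₃, j₃, t₃, hsq₃, hcomm₃, hCh₃⟩ :=
    modelStep_chain O k θ hθ P q Y hYirr hYcl Ch hChSplit hChStep X' σ' S' hCh' hX'reg hX'dom F₁ j t hsq T₁ hjT₁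
      C (vanishingIdeal (⟨Z, hZ⟩ : Closeds F₁)) hCj hCreg hCfl hoff hDT hTD X₃ τ₃ hτ₃ F₃ υ' hυ'
  rw [Scheme.IdealSheafData.coe_support_vanishingIdeal] at hirr₃ hCh₃
  haveI := hX₃n; haveI := hX₃i; haveI := hF₃i
  haveI hj₃ci : IsClosedImmersion j₃ := MorphismProperty.IsStableUnderBaseChange.of_isPullback hsq₃.flip inferInstance
  haveI : IsLocallyNoetherian F₃ := LocallyOfFiniteType.isLocallyNoetherian j₃
  -- the 2-frames of `C` (the curve clause and `n = 3`)
  have hfr : ∀ x ∈ C.support, ∃ c : Fin 2 → X'.presheaf.stalk x, Ideal.span (Set.range c) = stalkIdeal C x ∧ IsQuasiRegular c :=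
    hFrame_of_ringKrullDim_redSub O k θ hθ P q Y hYirr hYcl hPnoeth hPreg Ch hChSplit T₁ Z hZ hZdim X' σ' S' j t C hCh' hX'int hX'noeth
      hX'reg hX'dom hsq hjT₁ hCj hCfl hCreg
  -- the host letter of the strict transform (HT2′)
  have hL₉ : TCPlus.LetterDatum O P q Y F₃ X₃ (τ₃ ≫ σ') j₃ (closure (υ' ⁻¹' (closure E₁ \ Z))) :=
    TCPlus.letterDatum_transport_hostedRound' O k θ hθ q Y σ' hX'reg j t hsq isClosed_closure 𝓔 hEtr hEpr hEreg' hEoff hEfl h𝓔0 C hEC hZ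
      hCj hCfl hCreg hfr hτ₃ hυ' j₃ t₃ hsq₃ hcomm₃
  -- EVERY listed letter after the round: the host by HT2′, the others by (CL)-N (no regularity of `Z̃`)
  have hLs₃ : ∀ L ∈ Ls, TCPlus.LetterDatum O P q Y F₃ X₃ (τ₃ ≫ σ') j₃ (closure (υ' ⁻¹' (closure L \ Z))) := by
    intro L hL
    by_cases hLe : L = E₁
    · subst hLe; exact hL₉
    · obtain ⟨hc1, hc2⟩ := hOthers L hL hLe
      obtain ⟨𝓛, hl1, hl2, hl3, hl4, hl5⟩ := hLs L hL
      obtain ⟨h1, h2, h3, h4, h5⟩ := TCPlus.crossedLetter_clausesN k O θ hθ q Y σ' hX'reg hX₃r j t hsq C hZ hCj hCfl hCreg hC0 hZdim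
        hτ₃ hυ' j₃ t₃ hsq₃ hcomm₃ L 𝓛 hl1 hl2 hl3 hl4 hl5 hc1 hc2
      refine ⟨strictTransformIdeal τ₃ C 𝓛, ?_, h2, h3, h4, h5⟩
      rw [h1]
      congr 1
      exact Closeds.ext closure_closure.symm
  -- THE BIRTH of the exceptional letter (EB₀)
  have hE₃ : TCPlus.LetterDatum O P q Y F₃ X₃ (τ₃ ≫ σ') j₃ (υ' ⁻¹' Z) :=
    TCPlus.excLetter_birth₀ k O θ hθ q Y σ' hX'reg j t hsq C Z hZ hCj hCfl hCreg hfr hoff hτ₃ j₃ t₃ hsq₃ hcomm₃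
  exact ⟨X₃, τ₃ ≫ σ', _, j₃, t₃, hCh₃, hX₃i, hX₃n, hX₃r, hX₃dom, hsq₃, rfl, isClosed_closure, hirr₃, hF₃i, hLs₃, hE₃⟩

end Summit.ResolutionOfSingularities.ResolutionOfSingularities.Cruxes.EquisingularLiftNat.Sections

end
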